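import Literature.Topology.FourManifolds.BranchedDoubleCoverUnknot
import Literature.Topology.FourManifolds.GluckTwistTransport
import HarnessLib

/-!
# Transport of branched double covers along diffeomorphisms of `S⁴`; every unknotted 2-sphere
# has the branched double cover `(S⁴, half-turn)`

Topic `Literature/Topology/FourManifolds`; theorems about the relational predicate
`IsBranchedDoubleCover IX X K ι q` of `BranchedDoubleCoverTwoKnot.lean`, on the model of the
tree's `IsGluckTwist.map` / `IsGluckTwist.of_isIsotopic` (`GluckTwistTransport.lean`).

* `IsBranchedDoubleCover.map` — **naturality**: if `(X, ι, q)` is the double cover of `S⁴`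
  branched along `K`, then for every diffeomorphism `φ` of `S⁴` the triple `(X, ι, φ ∘ q)` is the
  double cover branched along the image knot `φ ∘ K` (`SphereEmbedding.map`), with the
  transported tubular neighbourhood `φ ∘ ν` (`TwoKnot.TubularNbhd.map`) and the same model
  embedding `j`;
* `IsBranchedDoubleCover.of_isIsotopic` — **isotopy invariance**: a branched double cover along
  `K` is (after composing `q` with the end stage of the ambient isotopy) a branched double cover
  along any 2-knot ambient isotopic to `K`;
* `BranchedUnknot.exists_isBranchedDoubleCover_of_isUnknot` — **`Σ₂(S⁴, U) = S⁴` with the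
  linear half-turn for every unknotted 2-knot `U`** (`TwoKnot.IsUnknot`, i.e. ambient isotopic
  to the equatorial `unknotTwo`): Miyazawa, arXiv:2312.02041, proof of Prop. 3.14, now for the
  whole isotopy class of the unknot — the standard example
  `BranchedUnknot.isBranchedDoubleCover_sphere_unknotTwo` (`BranchedDoubleCoverUnknot.lean`)
  transported by `map` and the symmetry of ambient isotopy (`IsAmbientIsotopic.symm_holds`);
* `BranchedUnknot.not_charged_of_isUnknot` is NOT restated: the deck involution is still
  `halfTurn`, so `BranchedDoubleCoverUnknotRound.not_charged_halfTurn` applies verbatim.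

Everything is a theorem; no named facts.

## References

* J. Miyazawa, arXiv:2312.02041 (2023), Prop. 3.14. [Miyazawa2023]
* R. E. Gompf, A. I. Stipsicz, *4-Manifolds and Kirby Calculus* (1999), §6.3. [GompfStipsicz1999]
* H. Gluck, Trans. AMS 104 (1962), §8 (transport of tubular neighbourhoods). [GluckTAMS1962]
-/

open scoped Manifold ContDiff Topology
open Function Set

noncomputable section

namespace Literature.Topology.FourManifolds

namespace IsBranchedDoubleCover

variable {EX HX : Type*} [NormedAddCommGroup EX] [NormedSpace ℝ EX] [TopologicalSpace HX]
  {IX : ModelWithCorners ℝ EX HX} {X : Type*} [TopologicalSpace X] [ChartedSpace HX X]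
  {K : TwoKnot} {ι : X → X} {q : X → Metric.sphere (0 : EuclideanSpace ℝ (Fin 5)) 1}

/-- **Naturality of branched double covers**: a branched double cover `(X, ι, q)` of `S⁴` along
`K` is, for every diffeomorphism `φ` of `S⁴`, the branched double cover `(X, ι, φ ∘ q)` along the
image knot `φ ∘ K` (transported tube `φ ∘ ν`, same model embedding; Gompf–Stipsicz (1999), §6.3,
Gluck (1962), §8). [cite: GompfStipsicz1999, §6.3] -/
theorem map (h : IsBranchedDoubleCover IX X K ι q)
    (φ : (Metric.sphere (0 : EuclideanSpace ℝ (Fin 5)) 1) ≃ₘ⟮𝓡 4, 𝓡 4⟯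
      (Metric.sphere (0 : EuclideanSpace ℝ (Fin 5)) 1)) :
    IsBranchedDoubleCover IX X (K.map φ) ι (φ ∘ q) := by
  -- off the image knot means off the knot
  have hoff : ∀ x, (φ ∘ q) x ∉ range (K.map φ) → q x ∉ range K := fun x hx hK ↦
    hx (by rw [SphereEmbedding.range_map]; exact ⟨q x, hK, rfl⟩)
  refine
    { contMDiff_proj := φ.contMDiff.comp h.contMDiff_proj
      contMDiff_deck := h.contMDiff_deck
      proj_deck := fun x ↦ by simp only [comp_apply, h.proj_deck]
      eq_or_eq_deck_of_proj_eq := fun x y hxy ↦ h.eq_or_eq_deck_of_proj_eq x y (φ.injective hxy)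
      proj_surjective := φ.surjective.comp h.proj_surjective
      deck_ne_of_notMem := fun x hx ↦ h.deck_ne_of_notMem x (hoff x hx)
      isLocalDiffeomorphAt_proj := fun x hx ↦
        (h.isLocalDiffeomorphAt_proj x (hoff x hx)).comp (K := 𝓡 4)
          (P := Metric.sphere (0 : EuclideanSpace ℝ (Fin 5)) 1) (φ.isLocalDiffeomorph (q x))
      exists_model := ?_ }
  obtain ⟨ν, j, hj, hjo, hqj, hιj, hrange⟩ := h.exists_model
  have hφ : Injective (φ : Metric.sphere (0 : EuclideanSpace ℝ (Fin 5)) 1 →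
      Metric.sphere (0 : EuclideanSpace ℝ (Fin 5)) 1) := φ.injective
  refine ⟨ν.map φ, j, hj, hjo, fun p w ↦ ?_, hιj, ?_⟩
  · simp only [comp_apply, hqj, TwoKnot.TubularNbhd.map_toFun]
  · rw [TwoKnot.TubularNbhd.map_toFun, Set.range_comp, Set.preimage_comp, hφ.preimage_image,
      hrange]

/-- **Isotopy invariance**: a branched double cover along `K` yields one along any 2-knot `K'`
ambient isotopic to `K` — compose `q` with the end stage `φ` of the ambient isotopy
(`K' = φ ∘ K`, `SphereEmbedding.IsIsotopic.exists_eq_map`). [cite: GompfStipsicz1999, §6.3] -/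
theorem of_isIsotopic (h : IsBranchedDoubleCover IX X K ι q) {K' : TwoKnot}
    (hK : K.IsIsotopic K') :
    ∃ φ : (Metric.sphere (0 : EuclideanSpace ℝ (Fin 5)) 1) ≃ₘ⟮𝓡 4, 𝓡 4⟯
      (Metric.sphere (0 : EuclideanSpace ℝ (Fin 5)) 1), IsBranchedDoubleCover IX X K' ι (φ ∘ q) := by
  obtain ⟨φ, rfl⟩ := hK.exists_eq_map
  exact ⟨φ, h.map φ⟩

end IsBranchedDoubleCover

namespace BranchedUnknot

/-- **Every unknotted 2-sphere has the branched double cover `(S⁴, half-turn)`**: if `U` is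
unknotted (ambient isotopic to the equatorial `unknotTwo`), then for the end stage `φ` of an
ambient isotopy from `unknotTwo` to `U`, the triple `(S⁴, halfTurn, φ ∘ fold)` is the double
cover of `S⁴` branched along `U` — Miyazawa, arXiv:2312.02041, proof of Prop. 3.14
("`Σ₂(S⁴, U)` is diffeomorphic to `S⁴` and the covering transformation is the linear
half-turn"), for the whole isotopy class of the unknot. [cite: Miyazawa2023, proof of Prop. 3.14] -/
theorem exists_isBranchedDoubleCover_of_isUnknot {U : TwoKnot} (hU : U.IsUnknot) :
    ∃ φ : (Metric.sphere (0 : EuclideanSpace ℝ (Fin 5)) 1) ≃ₘ⟮𝓡 4, 𝓡 4⟯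
      (Metric.sphere (0 : EuclideanSpace ℝ (Fin 5)) 1),
      IsBranchedDoubleCover (𝓡 4) (Metric.sphere (0 : EuclideanSpace ℝ (Fin 5)) 1) U halfTurn
        (φ ∘ fold) :=
  isBranchedDoubleCover_sphere_unknotTwo.of_isIsotopic (IsAmbientIsotopic.symm_holds hU)

end BranchedUnknot

end Literature.Topology.FourManifolds
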